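import Literature.NumberTheory.EllipticCurves.ShintaniLiftQExpansion
import Literature.NumberTheory.EllipticCurves.ModularSymbolsProofs
import HarnessLib

/-!
# The split orbit period as a difference of modular symbols

[[cite: Shintani1975, §2, Lemma 2.7 (ii) and §3 (computation of the coefficients by Manin's
modular symbols, Lemma 3.1)]] — for a split form the cycle `C(x)` joins the two root cusps, and
the period `∫₀^∞ (φ|M)(iy) i dy` of `ShintaniSplitOrbits` is the integral of `φ(w) dw` from the
cusp `M0` to the cusp `M∞`.  With the tree's Eichler integral `E = 2πi ∫_{i∞}^τ φ`
(`hasDerivAt_eichlerIntegral`) and `modularSymbol_smul_infty` (`E(Aτ) = {∞, A∞} + V_{φ|A}(τ)`)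
we PROVE:

* `hasDerivAt_moebR`, `hasDerivAt_axisE` (`d/dy E(M(iy)) = 2πi (φ|M)(iy) i`),
  `integral_slashSL_axis_eq` (FTC on `[y₁, y₂]`);
* `exists_norm_verticalIntegral_le`, `tendsto_verticalIntegral_of_im` (`V_ψ(τ) → 0`
  exponentially as `Im τ → ∞` for a cusp function `ψ`);
* `tendsto_axisE_atTop'` (`E(M(iy)) → {∞, M∞}`, `M = AN`), `axisE_eq_axisE_mul_S_inv`,
  `tendsto_axisE_nhdsGT_zero` (`E(M(iy)) → {∞, M0}` through `S`);
* **`period_eq_cuspValue_sub`** — `∫₀^∞ (φ|M)(iy) i dy = ({∞, M∞} - {∞, M0})/(2πi)` with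
  `cuspValue φ A = {∞, A∞}` (`0` for `A∞ = ∞`).

No named facts; the definitions are `moebR`, `axisE`, `cuspValue`.
-/

noncomputable section

open scoped MatrixGroups ModularForm Modular Topology
open UpperHalfPlane hiding I
open Complex Filter MeasureTheory Set CongruenceSubgroup ModularGroup Real MulAction
open Literature.NumberTheory.EllipticCurves.ModularForms

namespace Literature.NumberTheory.EllipticCurves.Shintani

/-! ### The real Möbius map of `M ∈ SL₂(ℝ)` and its derivative -/

/-- The Möbius map of `M ∈ SL₂(ℝ)` on `ℂ`. [folklore] -/
def moebR (M : SL(2, ℝ)) (τ : ℂ) : ℂ :=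
  (((M 0 0 : ℝ) : ℂ) * τ + ((M 0 1 : ℝ) : ℂ)) / (((M 1 0 : ℝ) : ℂ) * τ + ((M 1 1 : ℝ) : ℂ))

/-- `M • ofComplex τ = ofComplex (moebR M τ)` and its coordinate, for `Im τ > 0`. [folklore] -/
theorem coe_sl_smul_ofComplex (M : SL(2, ℝ)) {τ : ℂ} (hτ : 0 < τ.im) :
    (((M • UpperHalfPlane.ofComplex τ : ℍ)) : ℂ) = moebR M τ := by
  rw [sl_smul_ofComplex M hτ, UpperHalfPlane.ofComplex_apply_of_im_pos (moeb_im_pos M hτ)]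
  rfl

/-- `d/dτ moebR M τ = (M₁₀τ + M₁₁)⁻²`. [folklore] -/
theorem hasDerivAt_moebR (M : SL(2, ℝ)) {τ : ℂ} (hτ : 0 < τ.im) :
    HasDerivAt (moebR M) (1 / (((M 1 0 : ℝ) : ℂ) * τ + ((M 1 1 : ℝ) : ℂ)) ^ 2) τ := by
  have hd := moeb_denom_ne_zero' M hτ
  have hnum : HasDerivAt (fun z : ℂ ↦ ((M 0 0 : ℝ) : ℂ) * z + ((M 0 1 : ℝ) : ℂ)) ((M 0 0 : ℝ) : ℂ) τ := by
    simpa using ((hasDerivAt_id τ).const_mul ((M 0 0 : ℝ) : ℂ)).add_const ((M 0 1 : ℝ) : ℂ)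
  have hden : HasDerivAt (fun z : ℂ ↦ ((M 1 0 : ℝ) : ℂ) * z + ((M 1 1 : ℝ) : ℂ)) ((M 1 0 : ℝ) : ℂ) τ := by
    simpa using ((hasDerivAt_id τ).const_mul ((M 1 0 : ℝ) : ℂ)).add_const ((M 1 1 : ℝ) : ℂ)
  have hdet : ((M 0 0 : ℝ) : ℂ) * ((M 1 1 : ℝ) : ℂ) - ((M 0 1 : ℝ) : ℂ) * ((M 1 0 : ℝ) : ℂ) = 1 := by
    have := det_entries_real M
    exact_mod_cast this
  refine (hnum.div hden hd).congr_deriv ?_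
  rw [← hdet]
  ring

/-! ### The Eichler integral along the axis `M(iy)` -/

variable (f : CuspForm (Gamma0 64) 2)

/-- `F_M(y) = E_f(M(iy))`, the Eichler integral along the image of the imaginary axis. [folklore] -/
def axisE (M : SL(2, ℝ)) (y : ℝ) : ℂ :=
  eichlerIntegral f (UpperHalfPlane.ofComplex (moebR M ((y : ℂ) * I)))

/-- **`d/dy E_f(M(iy)) = 2πi · (φ|M)(iy) · i`** for `y > 0`. [folklore] -/
theorem hasDerivAt_axisE (M : SL(2, ℝ)) {y : ℝ} (hy : 0 < y) :
    HasDerivAt (axisE f M) (2 * Real.pi * I * (slashSL f M ((y : ℂ) * I) * I)) y := by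
  have hτ : 0 < (((y : ℂ) * I)).im := by simpa using hy
  have him := moeb_im_pos M hτ
  -- complex chain rule for `w ↦ E(ofComplex (moebR M (w I)))` at `w = y`
  have h1 : HasDerivAt (fun w : ℂ ↦ w * I) I (y : ℂ) := by simpa using (hasDerivAt_id (y : ℂ)).mul_const I
  have h2 : HasDerivAt ((moebR M) ∘ (fun w : ℂ ↦ w * I))
      (1 / (((M 1 0 : ℝ) : ℂ) * ((y : ℂ) * I) + ((M 1 1 : ℝ) : ℂ)) ^ 2 * I) (y : ℂ) :=
    HasDerivAt.comp (y : ℂ) (hasDerivAt_moebR M hτ) h1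
  have h3 := hasDerivAt_eichlerIntegral f him
  have h4 : HasDerivAt ((fun w : ℂ ↦ eichlerIntegral f (UpperHalfPlane.ofComplex w)) ∘ ((moebR M) ∘ (fun w : ℂ ↦ w * I)))
      (2 * Real.pi * I * f (UpperHalfPlane.ofComplex (moebR M ((y : ℂ) * I))) *
        (1 / (((M 1 0 : ℝ) : ℂ) * ((y : ℂ) * I) + ((M 1 1 : ℝ) : ℂ)) ^ 2 * I)) (y : ℂ) :=
    HasDerivAt.comp (y : ℂ) h3 h2
  have h5 : HasDerivAt (axisE f M) (2 * Real.pi * I * f (UpperHalfPlane.ofComplex (moebR M ((y : ℂ) * I))) *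
        (1 / (((M 1 0 : ℝ) : ℂ) * ((y : ℂ) * I) + ((M 1 1 : ℝ) : ℂ)) ^ 2 * I)) y :=
    h4.comp_ofReal
  refine h5.congr_deriv ?_
  -- identify the derivative with `2πi (φ|M)(iy) i`
  have hpt : UpperHalfPlane.ofComplex (moebR M ((y : ℂ) * I)) = M • UpperHalfPlane.ofComplex ((y : ℂ) * I) := by
    apply UpperHalfPlane.ext
    rw [coe_sl_smul_ofComplex M hτ]
    have h := UpperHalfPlane.ofComplex_apply_of_im_pos him
    change UpperHalfPlane.ofComplex (moebR M ((y : ℂ) * I)) = _ at h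
    rw [h]
    rfl
  rw [hpt, slashSL]
  ring

/-- **FTC on a segment**: `∫_{y₁}^{y₂} (φ|M)(iy) i dy = (E(M(iy₂)) - E(M(iy₁)))/(2πi)`
(`0 < y₁ ≤ y₂`). [folklore] -/
theorem integral_slashSL_axis_eq (M : SL(2, ℝ)) {y₁ y₂ : ℝ} (hy₁ : 0 < y₁) (hy₁₂ : y₁ ≤ y₂)
    (hint : IntervalIntegrable (fun y : ℝ ↦ slashSL f M ((y : ℂ) * I) * I) volume y₁ y₂) :
    ∫ y in y₁..y₂, slashSL f M ((y : ℂ) * I) * I = (axisE f M y₂ - axisE f M y₁) / (2 * Real.pi * I) := by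
  have h2pi : (2 * Real.pi * I : ℂ) ≠ 0 := by
    apply mul_ne_zero (mul_ne_zero two_ne_zero (Complex.ofReal_ne_zero.mpr Real.pi_pos.ne')) Complex.I_ne_zero
  have hderiv : ∀ y ∈ Set.uIcc y₁ y₂, HasDerivAt (axisE f M) (2 * Real.pi * I * (slashSL f M ((y : ℂ) * I) * I)) y := by
    intro y hy
    rw [Set.uIcc_of_le hy₁₂] at hy
    exact hasDerivAt_axisE f M (hy₁.trans_le hy.1)
  have hFTC := intervalIntegral.integral_eq_sub_of_hasDerivAt hderiv (hint.const_mul (2 * Real.pi * I))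
  rw [intervalIntegral.integral_const_mul] at hFTC
  rw [eq_div_iff h2pi, mul_comm, hFTC]

/-! ### Decay of the vertical-ray integral of a cusp function -/

/-- **`V_ψ(τ) → 0` exponentially as `Im τ → ∞`**: for a cusp function `ψ` of period `h`,
`‖V_ψ(τ)‖ ≤ K e^{-2π Im τ/h}` for `Im τ > 1/2`. [folklore] -/
theorem exists_norm_verticalIntegral_le {h : ℝ} {ψ : ℍ → ℂ} (hψ : IsCuspFunction h ψ) :
    ∃ K : ℝ, 0 ≤ K ∧ ∀ τ : ℍ, 1 / 2 < τ.im → ‖verticalIntegral ψ τ‖ ≤ K * Real.exp (-(2 * Real.pi / h) * τ.im) := by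
  obtain ⟨C, hC0, hC⟩ := HaberlandStokes.exists_norm_apply_le hψ
  have hb : 0 < 2 * Real.pi / h := div_pos (by positivity) hψ.pos
  have hint : IntegrableOn (fun t : ℝ ↦ Real.exp (-(2 * Real.pi / h) * t)) (Ioi 0) := exp_neg_integrableOn_Ioi 0 hb
  set K₀ : ℝ := ∫ t in Ioi (0 : ℝ), Real.exp (-(2 * Real.pi / h) * t) with hK₀
  have hK₀ : 0 ≤ K₀ := setIntegral_nonneg measurableSet_Ioi fun t _ ↦ (Real.exp_pos _).le
  refine ⟨2 * Real.pi * C * K₀, by positivity, fun τ hτ ↦ ?_⟩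
  rw [verticalIntegral, norm_mul, show ‖(2 * Real.pi : ℂ)‖ = 2 * Real.pi by
    rw [show (2 * Real.pi : ℂ) = ((2 * Real.pi : ℝ) : ℂ) by push_cast; ring, Complex.norm_real,
      Real.norm_of_nonneg (by positivity)]]
  have hbound : ∀ t ∈ Ioi (0 : ℝ), ‖ψ (UpperHalfPlane.ofComplex ((τ : ℂ) + t * I))‖ ≤
      C * Real.exp (-(2 * Real.pi / h) * τ.im) * Real.exp (-(2 * Real.pi / h) * t) := by
    intro t ht
    have him : ((τ : ℂ) + t * I).im = τ.im + t := by simp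
    have h1 := hC ((τ : ℂ) + t * I) (by rw [him]; linarith [le_of_lt (mem_Ioi.mp ht)])
    rw [him] at h1
    calc _ ≤ C * Real.exp (-(2 * Real.pi / h) * (τ.im + t)) := h1
      _ = _ := by rw [mul_add, Real.exp_add]; ring
  have h2 : ‖∫ t in Ioi (0 : ℝ), ψ (UpperHalfPlane.ofComplex ((τ : ℂ) + t * I))‖ ≤
      ∫ t in Ioi (0 : ℝ), C * Real.exp (-(2 * Real.pi / h) * τ.im) * Real.exp (-(2 * Real.pi / h) * t) := by
    refine norm_integral_le_of_norm_le (hint.const_mul _) ?_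
    rw [ae_restrict_iff' measurableSet_Ioi]
    exact Eventually.of_forall hbound
  rw [integral_const_mul] at h2
  calc 2 * Real.pi * ‖∫ t in Ioi (0 : ℝ), ψ (UpperHalfPlane.ofComplex ((τ : ℂ) + t * I))‖
      ≤ 2 * Real.pi * (C * Real.exp (-(2 * Real.pi / h) * τ.im) * K₀) := by gcongr
    _ = 2 * Real.pi * C * K₀ * Real.exp (-(2 * Real.pi / h) * τ.im) := by ring

/-- `V_ψ(τ_y) → 0` when `Im τ_y → ∞`. [folklore] -/
theorem tendsto_verticalIntegral_of_im {h : ℝ} {ψ : ℍ → ℂ} (hψ : IsCuspFunction h ψ) {ι : Type*}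
    {l : Filter ι} {τ : ι → ℍ} (hτ : Tendsto (fun i ↦ (τ i).im) l atTop) :
    Tendsto (fun i ↦ verticalIntegral ψ (τ i)) l (𝓝 0) := by
  obtain ⟨K, hK0, hK⟩ := exists_norm_verticalIntegral_le hψ
  have hb : 0 < 2 * Real.pi / h := div_pos (by positivity) hψ.pos
  rw [tendsto_zero_iff_norm_tendsto_zero]
  have hlim : Tendsto (fun i ↦ K * Real.exp (-(2 * Real.pi / h) * (τ i).im)) l (𝓝 0) := by
    have h1 : Tendsto (fun i ↦ Real.exp (-(2 * Real.pi / h) * (τ i).im)) l (𝓝 0) := by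
      refine Real.tendsto_exp_atBot.comp ?_
      exact (tendsto_neg_atTop_atBot.comp (hτ.const_mul_atTop hb)).congr fun i ↦ by simp only [Function.comp_apply]; ring
    simpa using h1.const_mul K
  refine squeeze_zero' (Eventually.of_forall fun i ↦ norm_nonneg _) ?_ hlim
  filter_upwards [hτ.eventually (eventually_gt_atTop (1 / 2))] with i hi using hK (τ i) hi

/-! ### The limits of `E(M(iy))` at `y → ∞` and `y → 0⁺` -/

/-- `M(iy) = A(N(iy))` and the point `N(iy)` for `M = A N`. [folklore] -/
theorem axisE_eq_of_fac {M : SL(2, ℝ)} {A : SL(2, ℤ)} {Nu : SL(2, ℝ)}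
    (hMfac : M = ((A : SL(2, ℤ)) : SL(2, ℝ)) * Nu) {y : ℝ} (hy : 0 < y) :
    axisE f M y = eichlerIntegral f (A • (Nu • UpperHalfPlane.ofComplex ((y : ℂ) * I))) := by
  have hτ : 0 < (((y : ℂ) * I)).im := by simpa using hy
  rw [axisE]
  congr 1
  apply UpperHalfPlane.ext
  rw [← coe_sl_smul_ofComplex M hτ, hMfac, mul_smul, UpperHalfPlane.ofComplex_apply]
  rfl

/-- **`E(M(iy)) → {∞, M∞}` as `y → ∞`** when `M∞ = A∞` is a finite cusp (`A₁₀ ≠ 0`). [folklore] -/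
theorem tendsto_axisE_atTop {M : SL(2, ℝ)} {A : SL(2, ℤ)} {Nu : SL(2, ℝ)} (hN : (Nu 1 0 : ℝ) = 0)
    (hMfac : M = ((A : SL(2, ℤ)) : SL(2, ℝ)) * Nu) (hA : (A 1 0 : ℤ) ≠ 0) :
    Tendsto (axisE f M) atTop (𝓝 (modularSymbol f (((A 0 0 : ℤ) : ℚ) / ((A 1 0 : ℤ) : ℚ)))) := by
  -- `E(A τ) = {∞, a/c} + V_{f|A}(τ)` with `τ = N(iy)`, `Im τ = N₀₀² y → ∞`
  set τ : ℝ → ℍ := fun y ↦ Nu • UpperHalfPlane.ofComplex (((max y 1 : ℝ) : ℂ) * I) with hτdef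
  have hkey : ∀ y : ℝ, 1 ≤ y → axisE f M y =
      modularSymbol f (((A 0 0 : ℤ) : ℚ) / ((A 1 0 : ℤ) : ℚ)) + verticalIntegral (⇑f ∣[(2 : ℤ)] A) (τ y) := by
    intro y hy
    have hy0 : 0 < y := by linarith
    rw [axisE_eq_of_fac f hMfac hy0, modularSymbol_smul_infty f A hA (τ y), hτdef]
    simp only [max_eq_left hy]
    ring
  have him : Tendsto (fun y ↦ (τ y).im) atTop atTop := by
    have hdet := det_entries_real Nu
    rw [hN, mul_zero, sub_zero] at hdet
    have ha : (Nu 0 0 : ℝ) ≠ 0 := by intro h0; rw [h0, zero_mul] at hdet; exact zero_ne_one hdet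
    have ha2 : 0 < (Nu 0 0 : ℝ) ^ 2 := by positivity
    have e : ∀ y : ℝ, (τ y).im = (Nu 0 0 : ℝ) ^ 2 * max y 1 := by
      intro y
      have hpos : 0 < (((max y 1 : ℝ) : ℂ) * I).im := by simp
      rw [hτdef]
      show (Nu • UpperHalfPlane.ofComplex (((max y 1 : ℝ) : ℂ) * I)).im = _
      rw [← UpperHalfPlane.coe_im, coe_upper_smul Nu hN, UpperHalfPlane.ofComplex_apply_of_im_pos hpos]
      simp [sq]
    simp_rw [e]
    exact (tendsto_atTop_mono (fun y ↦ le_max_left y 1) tendsto_id).const_mul_atTop ha2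
  have hV := tendsto_verticalIntegral_of_im (isCuspFunction_slash f A) him
  have hsum := (tendsto_const_nhds (x := modularSymbol f (((A 0 0 : ℤ) : ℚ) / ((A 1 0 : ℤ) : ℚ)))).add hV
  rw [add_zero] at hsum
  refine hsum.congr' ?_
  filter_upwards [eventually_ge_atTop (1 : ℝ)] with y hy using (hkey y hy).symm

/-- The value `{∞, A∞}` (`0` when `A∞ = ∞`). [folklore] -/
def cuspValue (A : SL(2, ℤ)) : ℂ :=
  if (A 1 0 : ℤ) = 0 then 0 else modularSymbol f (((A 0 0 : ℤ) : ℚ) / ((A 1 0 : ℤ) : ℚ))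

/-- **`E(M(iy)) → {∞, M∞}` as `y → ∞`** for `M = A N` (both cases `A∞` finite or `∞`). [folklore] -/
theorem tendsto_axisE_atTop' {M : SL(2, ℝ)} {A : SL(2, ℤ)} {Nu : SL(2, ℝ)} (hN : (Nu 1 0 : ℝ) = 0)
    (hMfac : M = ((A : SL(2, ℤ)) : SL(2, ℝ)) * Nu) :
    Tendsto (axisE f M) atTop (𝓝 (cuspValue f A)) := by
  by_cases hA : (A 1 0 : ℤ) = 0
  · rw [cuspValue, if_pos hA]
    -- `M` is upper triangular: `E(M(iy)) = V_f(M(iy)) → 0`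
    have hM10 : (M 1 0 : ℝ) = 0 := by
      rw [hMfac]
      have e : ((((A : SL(2, ℤ)) : SL(2, ℝ)) * Nu : SL(2, ℝ)) 1 0 : ℝ) =
          (((A : SL(2, ℤ)) : SL(2, ℝ)) 1 0 : ℝ) * Nu 0 0 + (((A : SL(2, ℤ)) : SL(2, ℝ)) 1 1 : ℝ) * Nu 1 0 := by
        simp [Matrix.mul_apply, Fin.sum_univ_two]
      rw [e, hN, mul_zero, add_zero]
      have : (((A : SL(2, ℤ)) : SL(2, ℝ)) 1 0 : ℝ) = ((A 1 0 : ℤ) : ℝ) := by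
        simp [Matrix.SpecialLinearGroup.map_apply_coe]
      rw [this, hA]; simp
    have him : Tendsto (fun y : ℝ ↦ (M • UpperHalfPlane.ofComplex (((max y 1 : ℝ) : ℂ) * I)).im) atTop atTop := by
      have hdet := det_entries_real M
      rw [hM10, mul_zero, sub_zero] at hdet
      have ha : (M 0 0 : ℝ) ≠ 0 := by intro h0; rw [h0, zero_mul] at hdet; exact zero_ne_one hdet
      have ha2 : 0 < (M 0 0 : ℝ) ^ 2 := by positivity
      have e : ∀ y : ℝ, (M • UpperHalfPlane.ofComplex (((max y 1 : ℝ) : ℂ) * I)).im = (M 0 0 : ℝ) ^ 2 * max y 1 := by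
        intro y
        have hpos : 0 < (((max y 1 : ℝ) : ℂ) * I).im := by simp
        rw [← UpperHalfPlane.coe_im, coe_upper_smul M hM10, UpperHalfPlane.ofComplex_apply_of_im_pos hpos]
        simp [sq]
      simp_rw [e]
      exact (tendsto_atTop_mono (fun y ↦ le_max_left y 1) tendsto_id).const_mul_atTop ha2
    have hV := tendsto_verticalIntegral_of_im (isCuspFunction_one f) him
    refine hV.congr' ?_
    filter_upwards [eventually_ge_atTop (1 : ℝ)] with y hy
    have hy0 : 0 < y := by linarith
    have hτ : 0 < (((y : ℂ) * I)).im := by simpa using hy0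
    rw [axisE, show eichlerIntegral f = verticalIntegral ⇑f from rfl, max_eq_left hy]
    congr 1
    apply UpperHalfPlane.ext
    rw [coe_sl_smul_ofComplex M hτ]
    have h := UpperHalfPlane.ofComplex_apply_of_im_pos (moeb_im_pos M hτ)
    change UpperHalfPlane.ofComplex (moebR M ((y : ℂ) * I)) = _ at h
    rw [h]
    rfl
  · rw [cuspValue, if_neg hA]
    exact tendsto_axisE_atTop f hN hMfac hA

/-- `M(iy) = (M S⁻¹)(i/y)`: `axisE M y = axisE (M S⁻¹) y⁻¹` for `y > 0`. [folklore] -/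
theorem axisE_eq_axisE_mul_S_inv (M : SL(2, ℝ)) {y : ℝ} (hy : 0 < y) :
    axisE f M y = axisE f (M * (((ModularGroup.S : SL(2, ℤ)) : SL(2, ℝ)))⁻¹) y⁻¹ := by
  have hτ : 0 < (((y : ℂ) * I)).im := by simpa using hy
  have hτ' : 0 < ((((y⁻¹ : ℝ) : ℂ)) * I).im := by simpa using hy
  -- both points of `ℍ`
  have ept : ∀ (P : SL(2, ℝ)) {w : ℂ} (hw : 0 < w.im),
      UpperHalfPlane.ofComplex (moebR P w) = P • UpperHalfPlane.ofComplex w := by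
    intro P w hw
    apply UpperHalfPlane.ext
    rw [coe_sl_smul_ofComplex P hw]
    have h := UpperHalfPlane.ofComplex_apply_of_im_pos (moeb_im_pos P hw)
    change UpperHalfPlane.ofComplex (moebR P w) = _ at h
    rw [h]
    rfl
  have hS := S_smul_ofComplex_polarPt hy (θ := π / 2) ⟨by positivity, by linarith [pi_pos]⟩
  rw [show π - π / 2 = π / 2 by ring, polarPt_pi_div_two, polarPt_pi_div_two] at hS
  rw [axisE, axisE, ept M hτ]
  -- the right-hand point
  have hpt : (((y : ℝ) : ℂ))⁻¹ * I = (((y⁻¹ : ℝ)) : ℂ) * I := by push_cast; rfl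
  have e2 := ept (M * (((ModularGroup.S : SL(2, ℤ)) : SL(2, ℝ)))⁻¹) hτ'
  rw [← hpt] at e2 hS ⊢
  rw [e2, ← hS, show ModularGroup.S • UpperHalfPlane.ofComplex ((y : ℂ) * I) =
      (((ModularGroup.S : SL(2, ℤ)) : SL(2, ℝ))) • UpperHalfPlane.ofComplex ((y : ℂ) * I) from rfl,
    ← mul_smul, inv_mul_cancel_right]

/-- **`E(M(iy)) → {∞, M0}` as `y → 0⁺`** (`M S⁻¹ = A' N'`, `M0 = A'∞`). [folklore] -/
theorem tendsto_axisE_nhdsGT_zero {M : SL(2, ℝ)} {A' : SL(2, ℤ)} {Nu' : SL(2, ℝ)} (hN' : (Nu' 1 0 : ℝ) = 0)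
    (hPfac : M * (((ModularGroup.S : SL(2, ℤ)) : SL(2, ℝ)))⁻¹ = ((A' : SL(2, ℤ)) : SL(2, ℝ)) * Nu') :
    Tendsto (axisE f M) (𝓝[>] 0) (𝓝 (cuspValue f A')) := by
  have h := (tendsto_axisE_atTop' f hN' hPfac).comp tendsto_inv_nhdsGT_zero
  refine h.congr' ?_
  filter_upwards [self_mem_nhdsWithin] with y hy
  exact (axisE_eq_axisE_mul_S_inv f M hy).symm

/-- **The split period as modular symbols**: for `M = A N` and `M S⁻¹ = A' N'`
(`A, A' ∈ SL₂(ℤ)`, `N, N'` upper triangular),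
`∫₀^∞ (φ|M)(iy) i dy = ({∞, M∞}_φ - {∞, M0}_φ) / (2πi)` with `{∞, r} = modularSymbol φ r`
(and `{∞, ∞} = 0`). [cite: Shintani1975, §2, Lemma 2.7 (ii); §3 (Manin's symbols)] -/
theorem period_eq_cuspValue_sub {M : SL(2, ℝ)} {A A' : SL(2, ℤ)} {Nu Nu' : SL(2, ℝ)}
    (hN : (Nu 1 0 : ℝ) = 0) (hMfac : M = ((A : SL(2, ℤ)) : SL(2, ℝ)) * Nu)
    (hN' : (Nu' 1 0 : ℝ) = 0)
    (hPfac : M * (((ModularGroup.S : SL(2, ℤ)) : SL(2, ℝ)))⁻¹ = ((A' : SL(2, ℤ)) : SL(2, ℝ)) * Nu') :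
    ∫ r in Ioi (0 : ℝ), slashSL f M (polarPt r (π / 2)) * unitAt (π / 2) =
      (cuspValue f A - cuspValue f A') / (2 * Real.pi * I) := by
  set g : ℝ → ℂ := fun y ↦ slashSL f M ((y : ℂ) * I) * I with hgdef
  have hfun : (fun r : ℝ ↦ slashSL f M (polarPt r (π / 2)) * unitAt (π / 2)) = g := by
    funext r; rw [hgdef, polarPt_pi_div_two, unitAt_pi_div_two]
  have hθ : π / 2 ∈ Ioo 0 π := ⟨by positivity, by linarith [pi_pos]⟩
  have hint : IntegrableOn g (Ioi 0) := by
    have h := integrableOn_ray f hN hMfac hN' hPfac 1 hθ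
    rw [← hfun]
    exact h.congr_fun (fun r _ ↦ by ring) measurableSet_Ioi
  rw [hfun]
  -- Step A: the integral over `(y₁, ∞)`
  have hA : ∀ y₁ : ℝ, 0 < y₁ → ∫ y in Ioi y₁, g y = (cuspValue f A - axisE f M y₁) / (2 * Real.pi * I) := by
    intro y₁ hy₁
    have hint₁ : IntegrableOn g (Ioi y₁) := hint.mono_set (Ioi_subset_Ioi hy₁.le)
    have T1 := intervalIntegral_tendsto_integral_Ioi y₁ hint₁ tendsto_id
    have T2 : Tendsto (fun b : ℝ ↦ ∫ y in y₁..b, g y) atTop (𝓝 ((cuspValue f A - axisE f M y₁) / (2 * Real.pi * I))) := by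
      have hlim := ((tendsto_axisE_atTop' f hN hMfac).sub_const (axisE f M y₁)).div_const (2 * Real.pi * I)
      refine hlim.congr' ?_
      filter_upwards [eventually_ge_atTop y₁] with b hb
      have hii : IntervalIntegrable g volume y₁ b :=
        (intervalIntegrable_iff_integrableOn_Ioc_of_le hb).mpr (hint₁.mono_set Ioc_subset_Ioi_self)
      exact (integral_slashSL_axis_eq f M hy₁ hb hii).symm
    exact tendsto_nhds_unique T1 T2
  -- Step B: `∫_{(y₁, ∞)} g → ∫_{(0, ∞)} g` as `y₁ → 0⁺`
  have hsplit : ∀ y₁ : ℝ, 0 < y₁ → ∫ y in Ioi y₁, g y = (∫ y in Ioi 0, g y) - ∫ y in (0 : ℝ)..y₁, g y := by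
    intro y₁ hy₁
    rw [intervalIntegral.integral_of_le hy₁.le, eq_sub_iff_add_eq, add_comm,
      ← setIntegral_union (Set.Ioc_disjoint_Ioi le_rfl) measurableSet_Ioi
        (hint.mono_set Ioc_subset_Ioi_self) (hint.mono_set (Ioi_subset_Ioi hy₁.le)),
      Ioc_union_Ioi_eq_Ioi hy₁.le]
  have hprim : Tendsto (fun y₁ : ℝ ↦ ∫ y in (0 : ℝ)..y₁, g y) (𝓝[>] 0) (𝓝 0) := by
    have hcont : ContinuousWithinAt (fun b : ℝ ↦ ∫ y in (0 : ℝ)..b, g y) (Icc 0 1) 0 := by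
      refine intervalIntegral.continuousWithinAt_primitive (measure_singleton 0) ?_
      rw [min_self, max_eq_right zero_le_one]
      exact (intervalIntegrable_iff_integrableOn_Ioc_of_le zero_le_one).mpr (hint.mono_set Ioc_subset_Ioi_self)
    have h := hcont.tendsto
    rw [intervalIntegral.integral_same] at h
    rw [← nhdsWithin_Ioc_eq_nhdsGT zero_lt_one]
    exact h.mono_left (nhdsWithin_mono _ Ioc_subset_Icc_self)
  have TB : Tendsto (fun y₁ : ℝ ↦ ∫ y in Ioi y₁, g y) (𝓝[>] 0) (𝓝 (∫ y in Ioi 0, g y)) := by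
    have h := (tendsto_const_nhds (x := ∫ y in Ioi 0, g y)).sub hprim
    rw [sub_zero] at h
    refine h.congr' ?_
    filter_upwards [self_mem_nhdsWithin] with y₁ hy₁
    exact (hsplit y₁ hy₁).symm
  -- Step C: compare with the limit of Step A's right-hand side
  have TC : Tendsto (fun y₁ : ℝ ↦ ∫ y in Ioi y₁, g y) (𝓝[>] 0)
      (𝓝 ((cuspValue f A - cuspValue f A') / (2 * Real.pi * I))) := by
    have hlim := ((tendsto_const_nhds (x := cuspValue f A)).sub
      (tendsto_axisE_nhdsGT_zero f hN' hPfac)).div_const (2 * Real.pi * I)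
    refine hlim.congr' ?_
    filter_upwards [self_mem_nhdsWithin] with y₁ hy₁
    exact (hA y₁ hy₁).symm
  exact tendsto_nhds_unique TB TC

end Literature.NumberTheory.EllipticCurves.Shintani
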